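import Literature.NumberTheory.IwasawaTheory.ClassicalMuVanishesQuadraticAscent
import Literature.NumberTheory.NumberFields.AmbiguousClassNumberNarrowInequality
import HarnessLib

/-!
# «KIDA-LITE» at `ℓ = 2`: Iwasawa's `μ = 0` ASCENDS a quadratic extension `K'/K` (`K'` totally complex) whenever `μ(K) = 0` AND the
# NARROW defect `ord₂ h⁺(K·F_n) − ord₂ h(K·F_n)` is bounded along the tower (proved; no definition, no named fact)

`Proofs`-style file (theorems only) in topic `NumberTheory/IwasawaTheory` (namespace `Literature.NumberTheory.IwasawaTheory`), written by the
prover seat `cruxlead-stmt-BirchSwinnertonDyer-19573-w2` GEN 8 (cell `bsd-2adic`; `--supports` stmt-BirchSwinnertonDyer-19573; closes nothing).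
Module (T⁺) of the seat's «Kida-lite at `ℓ = 2`»; it is GEN 7's `classicalMuVanishes_restrict_of_quadratic_of_signVec_surjective`
(`ClassicalMuVanishesQuadraticAscent.lean`) with its per-layer hypothesis «the unit signature map of `A_n` is ONTO» (narrow defect `0`) replaced
by «the narrow defect of `A_n` is at most `D`», through module (L⁺) `AmbiguousClass.padicValNat_two_card_fixed_add_one_le_narrowClassNumber`
(Chevalley at `2` with `h⁺`, no unit hypothesis).

THE THEOREM (`classicalMuVanishes_restrict_of_quadratic_of_narrowDefect_le`). `F` a number field, `κ` a `ℤ₂`-extension of `F` (layers `F_n ⊆ F̄`),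
`K ⊆ K'` number fields over `F` with `[K' : K] = 2`, `K'` TOTALLY COMPLEX, both linearly disjoint from `F_∞` (`κ ∘ res` onto), `j' : K' → F̄` over
`F`, `j = j'|_K`; layers `A_n = j(K)·F_n ⊆ B_n = j'(K')·F_n` of the restricted towers. HYPOTHESES, for every `n`: (i) at most `T` primes of `A_n`
ramify in `B_n`; (ii) **`ord₂ h⁺(A_n) ≤ ord₂ h(A_n) + D`** (bounded narrow defect; for `A_n` totally real this is `#(U⁺/U²)(A_n) ∣ 2^D`, and
`D = 0` iff the units of `A_n` take every signature — GEN 7's case). CONCLUSION: `ClassicalMuVanishes (κ|_K) ⟹ ClassicalMuVanishes (κ|_{K'})`.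

WHY «Kida-lite».  For a CM field `k = k⁺(√−m)` and the cyclotomic `ℤ₂`-extension, Kida (J. Number Theory 14 (1982)) relates the Iwasawa
invariants of `k` to those of the NARROW (strict) class groups of the layers of `k⁺`; the `μ`-part of that transfer reads «`μ(k) = 0` iff the
narrow Iwasawa module of `k⁺_∞/k⁺` has `μ = 0`», and «`μ(κ|_K) = 0` ∧ (ii)» is exactly the numerical shadow of the latter (bounded `2`-ranks
of the narrow class groups ⟺ bounded `2`-ranks of the class groups AND bounded `P/P⁺`-kernels, the kernel `P_n/P_n⁺` being `2`-elementary of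
order `2^{δ_n}`).  Only the direction «⟹ `μ(k) = 0`» is proved here, for any base `F`, any quadratic `K'/K` with `K'` totally complex, at
finite level (no `Λ`-modules): `μ(κ|_K) = 0` bounds `rank₂ Cl(A_n) ≤ R` (tree); (L⁺) gives `ord₂ #Cl(B_n)^G + 1 ≤ ord₂ #Cl(A_n) + T + D`; the
group-theoretic module (G) (`CyclicRankBound.padicValNat_card_quotient_le_of_fixed`) gives `rank₂ Cl(B_n) ≤ 2(2R + T + D)`; bounded ranks give
`μ(κ|_{K'}) = 0` (tree `classicalMuVanishes_of_forall_classGroupPRank_le`).  The converse and the `λ`-formula are NOT claimed.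

* `classicalMuVanishes_restrict_of_quadratic_of_narrowDefect_le` (main), and the corollary
  `classicalMuVanishes_restrict_of_quadratic_of_narrowClassNumber_eq` (case `ord₂ h⁺(A_n) = ord₂ h(A_n)` for all `n`, which contains
  GEN 7's signature-onto theorem).

References: [Kida1982JFields] Y. Kida, *Cyclotomic ℤ₂-extensions of J-fields*, J. Number Theory 14 (1982) 340–352 (shape of the transfer;
not held — cited through arXiv:1103.3916 §1); [Iwasawa1973MuInvariants] Thm. 2/3 («let `k` be totally imaginary if `ℓ = 2`»); [Washington1997]
§13.3 Prop. 13.23; [Lang1990] Ch. 13 §4 Lemma 4.1; [Gras2003] IV.4; [FrohlichTaylor1990] Ch. V §1 (1.12).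
-/

set_option autoImplicit false

noncomputable section

open scoped NumberField Classical
open NumberField Field IntermediateField IsDedekindDomain

namespace Literature.NumberTheory.IwasawaTheory

open Literature.NumberTheory.EllipticCurves Literature.NumberTheory.EllipticCurves.ZpExtension
  Literature.NumberTheory.GaloisRepresentations Literature.NumberTheory.NumberFields
  Literature.NumberTheory.NumberFields.AmbiguousClass Literature.NumberTheory.NumberFields.CyclicRankBound
  Literature.Geometry.Kaehler.ComplexTorus

variable {F : Type} [Field F] [NumberField F]

/-- **Kida-lite at `ℓ = 2`: Iwasawa's `μ = 0` ascends a quadratic extension under a BOUNDED NARROW DEFECT.** `κ` a `ℤ₂`-extension of the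
number field `F`; `K ⊆ K'` number fields over `F`, `[K' : K] = 2`, `K'` totally complex, `κ ∘ res` onto for both (linear disjointness from
`F_∞`); `j' : K' → F̄` over `F`, `j = j'|_K`, layers `A_n = j(K)·F_n ⊆ B_n = j'(K')·F_n`. If for every `n` (i) at most `T` primes of `A_n`
ramify in `B_n` and (ii) `ord₂ h⁺(A_n) ≤ ord₂ h(A_n) + D` (narrow class number vs class number), then
`ClassicalMuVanishes (κ|_K) ⟹ ClassicalMuVanishes (κ|_{K'})`. Finite-level proof: bounded `2`-ranks downstairs (tree) ⟹ per layer
`ord₂ #Cl(B_n)^G + 1 ≤ ord₂ h⁺(A_n) + t_n ≤ ord₂ #Cl(A_n) + T + D` (module (L⁺), Chevalley with the narrow class number) ⟹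
`rank₂ Cl(B_n) ≤ 2(2R + T + D)` (module (G)) ⟹ `μ = 0` upstairs (tree). GEN 7's signature-onto theorem is the case `D = 0`
(`ord₂ h⁺(A_n) = ord₂ h(A_n)`). [cite: Iwasawa1973MuInvariants, Thm. 2 and Thm. 3 (ℓ = 2: «k totally imaginary»; replaced here by (ii))]
[cite: Washington1997, §13.3 Prop. 13.23] [cite: Lang1990, Ch. 13 §4 Lemma 4.1] [cite: FrohlichTaylor1990, Ch. V §1 (1.12), p. 164] -/
theorem classicalMuVanishes_restrict_of_quadratic_of_narrowDefect_le (κ : ZpExtension F 2) (K K' : Type) [Field K]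
    [NumberField K] [Algebra F K] [Field K'] [NumberField K'] [Algebra F K'] [Algebra K K'] [IsScalarTower F K K']
    [IsTotallyComplex K'] (hdeg : Module.finrank K K' = 2)
    (hK : Function.Surjective (κ.toContinuousMonoidHom.comp (absGaloisRestrict F K)))
    (hK' : Function.Surjective (κ.toContinuousMonoidHom.comp (absGaloisRestrict F K')))
    (j' : K' →ₐ[F] AlgebraicClosure F) (T D : ℕ)
    (hram : ∀ n : ℕ,
      letI : Algebra ↥((j'.comp (IsScalarTower.toAlgHom F K K')).fieldRange ⊔ κ.layer n) ↥(j'.fieldRange ⊔ κ.layer n) :=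
        (IntermediateField.inclusion (fieldRange_comp_sup_layer_le κ K K' j' n)).toRingHom.toAlgebra
      {v : HeightOneSpectrum (𝓞 ↥((j'.comp (IsScalarTower.toAlgHom F K K')).fieldRange ⊔ κ.layer n)) |
        v.asIdeal.ramificationIdxIn (𝓞 ↥(j'.fieldRange ⊔ κ.layer n)) ≠ 1}.ncard ≤ T)
    (hδ : ∀ n : ℕ,
      haveI : NumberField ↥((j'.comp (IsScalarTower.toAlgHom F K K')).fieldRange ⊔ κ.layer n) :=
        numberField_fieldRange_sup_layer κ K (j'.comp (IsScalarTower.toAlgHom F K K')) n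
      padicValNat 2 (narrowClassNumber ↥((j'.comp (IsScalarTower.toAlgHom F K K')).fieldRange ⊔ κ.layer n)) ≤
        padicValNat 2 (classNumber ↥((j'.comp (IsScalarTower.toAlgHom F K K')).fieldRange ⊔ κ.layer n)) + D)
    (hμ : ClassicalMuVanishes (κ.restrict K hK)) :
    ClassicalMuVanishes (κ.restrict K' hK') := by
  haveI : Fact (Nat.Prime 2) := ⟨Nat.prime_two⟩
  haveI : FiniteDimensional F K := Module.Finite.of_restrictScalars_finite ℚ F K
  haveI : FiniteDimensional F K' := Module.Finite.of_restrictScalars_finite ℚ F K'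
  haveI : FiniteDimensional K K' := Module.Finite.of_restrictScalars_finite F K K'
  -- bounded `2`-ranks downstairs
  obtain ⟨R, hR⟩ := exists_forall_classGroupPRank_le_of_classicalMuVanishes (κ.restrict K hK) hμ
  refine classicalMuVanishes_of_forall_classGroupPRank_le (κ.restrict K' hK') (B := 2 * (2 * R + (T + D))) fun n ↦ ?_
  -- the layers `A = j(K)·F_n ⊆ B = j'(K')·F_n`
  set j : K →ₐ[F] AlgebraicClosure F := j'.comp (IsScalarTower.toAlgHom F K K') with hj
  set A : IntermediateField F (AlgebraicClosure F) := j.fieldRange ⊔ κ.layer n with hA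
  set B : IntermediateField F (AlgebraicClosure F) := j'.fieldRange ⊔ κ.layer n with hB
  have hAB : A ≤ B := fieldRange_comp_sup_layer_le κ K K' j' n
  haveI : NumberField ↥A := numberField_fieldRange_sup_layer κ K j n
  haveI : NumberField ↥B := numberField_fieldRange_sup_layer κ K' j' n
  letI : Algebra ↥A ↥B := (IntermediateField.inclusion hAB).toRingHom.toAlgebra
  haveI : IsScalarTower F ↥A ↥B := IsScalarTower.of_algebraMap_eq fun x ↦ rfl
  haveI : Module.Free ↥A ↥B := Module.Free.of_divisionRing ↥A ↥B
  haveI : FiniteDimensional ↥A ↥B := Module.Finite.of_restrictScalars_finite F ↥A ↥B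
  -- `[B : A] = [K' : K] = 2`
  have hdA : Module.finrank F ↥A = Module.finrank F K * 2 ^ n := finrank_fieldRange_sup_layer κ K hK j n
  have hdB : Module.finrank F ↥B = Module.finrank F K' * 2 ^ n := finrank_fieldRange_sup_layer κ K' hK' j' n
  have hdegAB : Module.finrank ↥A ↥B = 2 := by
    have htower := Module.finrank_mul_finrank F ↥A ↥B
    have hKK' := Module.finrank_mul_finrank F K K'
    have hA0 : 0 < Module.finrank F ↥A := Module.finrank_pos
    have h1 : Module.finrank F ↥A * Module.finrank ↥A ↥B = Module.finrank F ↥A * 2 := by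
      rw [htower, hdB, hdA, ← hKK', hdeg]; ring
    exact Nat.eq_of_mul_eq_mul_left hA0 h1
  haveI : Algebra.IsQuadraticExtension ↥A ↥B := ⟨hdegAB⟩
  haveI : IsGalois ↥A ↥B := inferInstance
  -- `B` is totally complex (it contains a copy of `K'`)
  haveI : IsTotallyComplex ↥B := by
    letI : Algebra K' ↥B :=
      ((IntermediateField.inclusion (le_sup_left : j'.fieldRange ≤ B)).comp
        (AlgEquiv.ofInjectiveField j').toAlgHom).toRingHom.toAlgebra
    exact isTotallyComplex_of_algebra (F := K') ↥B
  -- a generator of `Gal(B/A) ≅ C₂`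
  obtain ⟨σ, hσ⟩ := IsCyclic.exists_generator (α := ↥B ≃ₐ[↥A] ↥B)
  have hcard : Fintype.card (↥B ≃ₐ[↥A] ↥B) = 2 := by
    rw [← Nat.card_eq_fintype_card, IsGalois.card_aut_eq_finrank, hdegAB]
  have hσ2 : σ * σ = 1 := by rw [← pow_two, ← hcard, pow_card_eq_one]
  -- module (L⁺): Chevalley with the narrow class number on this layer
  have hchev := padicValNat_two_card_fixed_add_one_le_natCard_classGroup_add_narrowDefect (K := ↥A) (L := ↥B) hdegAB hσ
  have htn : {v : HeightOneSpectrum (𝓞 ↥A) | v.asIdeal.ramificationIdxIn (𝓞 ↥B) ≠ 1}.ncard ≤ T := hram n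
  have hδn : padicValNat 2 (narrowClassNumber ↥A) ≤ padicValNat 2 (classNumber ↥A) + D := hδ n
  -- the action on `Cl(B)` and its fixed classes
  set f : ClassGroup (𝓞 ↥B) ≃* ClassGroup (𝓞 ↥B) := ClassGroup.mulEquiv (intAut σ) with hf
  have hfixed : Nat.card {c : ClassGroup (𝓞 ↥B) // ∀ τ : ↥B ≃ₐ[↥A] ↥B, ClassGroup.mulEquiv (intAut τ) c = c} =
      Nat.card (f.toMonoidHom.eqLocus (MonoidHom.id _)) :=
    natCard_fixed_eq_natCard_eqLocus_of_generator (fun τ : ↥B ≃ₐ[↥A] ↥B ↦ ClassGroup.mulEquiv (intAut τ))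
      mulEquiv_intAut_one mulEquiv_intAut_mul hσ
  have hff : ∀ b : ClassGroup (𝓞 ↥B), (⇑f.toMonoidHom)^[2] b = b := fun b ↦ by
    rw [Function.iterate_succ_apply, Function.iterate_one, MulEquiv.coe_toMonoidHom, hf, ← MulEquiv.trans_apply,
      ← mulEquiv_intAut_mul, hσ2, mulEquiv_intAut_one, MulEquiv.refl_apply]
  -- module (G): the rank bound
  have hNj : ∀ a : ClassGroup (𝓞 ↥A), classGroupNorm ↥A ↥B (classGroupExtend ↥A ↥B a) = a ^ 2 := fun a ↦ by
    rw [classGroupNorm_classGroupExtend, hdegAB]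
  have hjfix : ∀ a : ClassGroup (𝓞 ↥A), f.toMonoidHom (classGroupExtend ↥A ↥B a) = classGroupExtend ↥A ↥B a := fun a ↦ by
    rw [MulEquiv.coe_toMonoidHom, hf, mulEquiv_intAut_classGroupExtend]
  have hfix : padicValNat 2 (Nat.card (f.toMonoidHom.eqLocus (MonoidHom.id _))) ≤
      padicValNat 2 (Nat.card (ClassGroup (𝓞 ↥A))) + (T + D) := by
    rw [← hfixed]
    omega
  have hrank := padicValNat_card_quotient_le_of_fixed 2 f.toMonoidHom hff (classGroupExtend ↥A ↥B) (classGroupNorm ↥A ↥B)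
    hNj hjfix (T + D) hfix
  -- transport to the layers of the restricted towers
  rw [classGroupPRank_restrict_eq κ K' hK' j' n]
  have hRn := hR n
  rw [classGroupPRank_restrict_eq κ K hK j n] at hRn
  calc padicValNat 2 (Nat.card (ClassGroup (𝓞 ↥B) ⧸ (powMonoidHom 2 : ClassGroup (𝓞 ↥B) →* _).range))
      ≤ 2 * (2 * padicValNat 2 (Nat.card (ClassGroup (𝓞 ↥A) ⧸ (powMonoidHom 2 : ClassGroup (𝓞 ↥A) →* _).range)) + (T + D)) := hrank
    _ ≤ 2 * (2 * R + (T + D)) := by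
        apply Nat.mul_le_mul_left
        exact Nat.add_le_add_right (Nat.mul_le_mul_left 2 hRn) (T + D)

/-- **Corollary: the ascent when the narrow and the wide `2`-class numbers of the layers agree** (`ord₂ h⁺(A_n) = ord₂ h(A_n)` for all `n`;
e.g. the units of every `A_n` take every signature — GEN 7's `classicalMuVanishes_restrict_of_quadratic_of_signVec_surjective` — or `A_n`
totally real with every totally positive unit a square). [cite: Iwasawa1973MuInvariants, Thm. 2 and Thm. 3] [cite: Washington1997, §13.3 Prop. 13.23]
[cite: FrohlichTaylor1990, Ch. V §1 (1.12), p. 164] -/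
theorem classicalMuVanishes_restrict_of_quadratic_of_narrowClassNumber_eq (κ : ZpExtension F 2) (K K' : Type) [Field K]
    [NumberField K] [Algebra F K] [Field K'] [NumberField K'] [Algebra F K'] [Algebra K K'] [IsScalarTower F K K']
    [IsTotallyComplex K'] (hdeg : Module.finrank K K' = 2)
    (hK : Function.Surjective (κ.toContinuousMonoidHom.comp (absGaloisRestrict F K)))
    (hK' : Function.Surjective (κ.toContinuousMonoidHom.comp (absGaloisRestrict F K')))
    (j' : K' →ₐ[F] AlgebraicClosure F) (T : ℕ)
    (hram : ∀ n : ℕ,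
      letI : Algebra ↥((j'.comp (IsScalarTower.toAlgHom F K K')).fieldRange ⊔ κ.layer n) ↥(j'.fieldRange ⊔ κ.layer n) :=
        (IntermediateField.inclusion (fieldRange_comp_sup_layer_le κ K K' j' n)).toRingHom.toAlgebra
      {v : HeightOneSpectrum (𝓞 ↥((j'.comp (IsScalarTower.toAlgHom F K K')).fieldRange ⊔ κ.layer n)) |
        v.asIdeal.ramificationIdxIn (𝓞 ↥(j'.fieldRange ⊔ κ.layer n)) ≠ 1}.ncard ≤ T)
    (hnw : ∀ n : ℕ,
      haveI : NumberField ↥((j'.comp (IsScalarTower.toAlgHom F K K')).fieldRange ⊔ κ.layer n) :=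
        numberField_fieldRange_sup_layer κ K (j'.comp (IsScalarTower.toAlgHom F K K')) n
      padicValNat 2 (narrowClassNumber ↥((j'.comp (IsScalarTower.toAlgHom F K K')).fieldRange ⊔ κ.layer n)) =
        padicValNat 2 (classNumber ↥((j'.comp (IsScalarTower.toAlgHom F K K')).fieldRange ⊔ κ.layer n)))
    (hμ : ClassicalMuVanishes (κ.restrict K hK)) :
    ClassicalMuVanishes (κ.restrict K' hK') :=
  classicalMuVanishes_restrict_of_quadratic_of_narrowDefect_le κ K K' hdeg hK hK' j' T 0 hram (fun n ↦ by
    have h := hnw n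
    omega) hμ

end Literature.NumberTheory.IwasawaTheory

end
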